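import Literature.NumberTheory.Automorphic.CDTTheorem712
import Literature.NumberTheory.EllipticCurves.ModFiveCongruenceHesseFamily
import Literature.NumberTheory.EllipticCurves.ModThreeReducibleIffPsi3Root
import Literature.NumberTheory.EllipticCurves.TorsionFrobenius
import Literature.NumberTheory.EllipticCurves.SemistableModPImageReducibleProofs
import Literature.NumberTheory.DiophantineGeometry.MinimalDiscriminant
import HarnessLib

/-!
# Stub-ideation k = 2, GENERATION 2 (HOME FAMILY 2 — RESHAPE) for `stub_switch` of crux `FreyModularity`

Companion to `STUB-IDEAS-stub_switch-2.md` (gen 2).  Helper SIGNATURES (must elaborate; proofs are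
`sorry` unless short), plus the PROVED top glue `stubSwitch_of_cuspForcedSource`.
The registered stub (`Lines/Sketch.lean`, `stub_switch`, `Iff.rfl`-equal to the named fact
`BCDT.CDT_three_five_switch`) is NOT retyped as a target: `StubSwitch` below is its signature verbatim,
used only as the conclusion of the glue.

PLAN (NONSPLIT-CUSP FORCING): fix a Chebotarev prime `q` FIRST (`Frob_q = −1` on `W[5]`,
`q ≡ 1 mod 120·N_W`), then pick the member `E_l` of Fisher's `5`-congruence family `X_W(5) ≅ ℙ¹`
`q`-adically next to a cusp (`v_q 𝔇_W(l,1) = 1`).  Then `E_l[5] ≅ W[5]` (tree named fact), `E_l` is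
multiplicative at `q` with `v_q(Δ_min) = 5`, NONSPLIT (read off through `E_l[5] ≅ W[5]`), so a
`Γ_ℚ`-stable line in `E_l[3]` would be the Tate line with `Frob_q`-eigenvalue `−q ≡ −1 (mod 3)`, while
its (quadratic, unramified outside `30·N_W`) character takes the value `+1` at `q ≡ 1 (mod 120 N_W)`:
contradiction; irreducible + an inertial transvection at `q` (`3 ∤ 5`) ⇒ `ρ̄_{E_l,3}` onto.
-/

set_option linter.dupNamespace false
set_option linter.unusedVariables false

noncomputable section

open scoped NumberField
open Literature.NumberTheory.EllipticCurves Literature.NumberTheory.EllipticCurves.HesseFamilyFive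
open Literature.NumberTheory.Automorphic Literature.NumberTheory.GaloisRepresentations
open Literature.NumberTheory.Automorphic.BCDT WeierstrassCurve Field NumberField IsDedekindDomain Matrix

namespace Summit.ABC.ABC.Cruxes.FreyModularity.StubSwitchIdeas2G2

/-- `Sig.stub_switch` verbatim (the registered stub's statement). -/
def StubSwitch : Prop :=
  ∀ (W : WeierstrassCurve ℚ) [W.IsElliptic], ¬ 27 ∣ W.conductorNorm ℤ →
    (∀ ρ₃ : ModPGaloisRep ℚ (ZMod 3) 2, W.IsTorsionGaloisRep 3 ρ₃ →
      ¬ ρ₃.IsAbsIrreducibleOverSqrt (-3)) →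
    ∀ (ρ : ModPGaloisRep ℚ (ZMod 5) 2), W.IsTorsionGaloisRep 5 ρ → ρ.IsAbsIrreducibleOverSqrt 5 →
    ∃ (W' : WeierstrassCurve ℚ) (_ : W'.IsElliptic), W'.IsTorsionGaloisRep 5 ρ ∧
      ∃ ρ₃' : ModPGaloisRep ℚ (ZMod 3) 2, W'.IsTorsionGaloisRep 3 ρ₃' ∧
        ρ₃'.IsAbsIrreducibleOverSqrt (-3)

theorem stubSwitch_iff_CDT_three_five_switch : StubSwitch ↔ CDT_three_five_switch := Iff.rfl

/-- Member `E_{l,m}` of Fisher's `5`-congruence family of the `c₄c₆`-model `y² = x³ − 27c₄x − 54c₆`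
(tree `HesseFamilyFive.C4/C6`; same abbreviation as the k = 3 sketch). -/
abbrev member (c₄ c₆ l m : ℚ) : WeierstrassCurve ℚ :=
  ⟨0, 0, 0, -27 * C4 c₄ c₆ l m, -54 * C6 c₄ c₆ l m⟩

/-- The `c₄c₆`-model (= the member at `(l:m) = (1:0)`). -/
abbrev base (c₄ c₆ : ℚ) : WeierstrassCurve ℚ := ⟨0, 0, 0, -27 * c₄, -54 * c₆⟩

/-! ## Layer 1 — the reshaped target and the PROVED top glue -/

/-- **T1 `CuspForcedSource` (the reshaped 3-side; weaker than k3's `EllipticSourceSwitch` because it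
USES the stub's hypothesis `ρ̄_{W,5}` absolutely irreducible over `ℚ(√5)`, which is what makes
`−1 ∈ ρ̄([Γ_ℚ,Γ_ℚ])` and hence a Chebotarev prime `q ≡ 1 (mod m)` with `Frob_q = −1` available).** -/
def CuspForcedSource : Prop :=
  ∀ (W : WeierstrassCurve ℚ) [W.IsElliptic] (ρ : ModPGaloisRep ℚ (ZMod 5) 2),
    W.IsTorsionGaloisRep 5 ρ → ρ.IsAbsIrreducibleOverSqrt 5 →
    ∃ (W' : WeierstrassCurve ℚ) (_ : W'.IsElliptic), Congr W' W ∧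
      W'.HasSurjectiveModNGaloisRep ((3 : ℕ) : ℤ)

/-- transport of a framed `5`-torsion model along a `5`-congruence (k3's H1, PROVED; 5 lines). -/
theorem isTorsionGaloisRep_of_congr {W W' : WeierstrassCurve ℚ} (h : Congr W' W)
    {ρ : ModPGaloisRep ℚ (ZMod 5) 2} (hρ : W.IsTorsionGaloisRep 5 ρ) :
    W'.IsTorsionGaloisRep 5 ρ := by
  obtain ⟨e', he'⟩ := h
  obtain ⟨e, he⟩ := hρ
  refine ⟨e'.trans e, fun σ P => ?_⟩
  rw [AddEquiv.trans_apply, AddEquiv.trans_apply, he', he]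

/-- intrinsic onto ⇒ framed onto (IN TREE, PROVED: `Summit.ABC.ABC.Theorems.surjective_of_hasSurjectiveModNGaloisRep`;
copied as in the k = 3 sketch to keep this file's imports light). -/
theorem surjective_of_hasSurjectiveModNGaloisRep {F : Type} [Field F] {W : WeierstrassCurve F}
    {p : ℕ} [Fact p.Prime] (hs : W.HasSurjectiveModNGaloisRep (p : ℤ)) {ρ : ModPGaloisRep F (ZMod p) 2}
    (hρ : W.IsTorsionGaloisRep p ρ) : Function.Surjective ρ := by
  obtain ⟨e, he⟩ := hρ
  intro M
  let f : (Fin 2 → ZMod p) ≃+ (Fin 2 → ZMod p) :=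
    { toFun := fun v ↦ (M : Matrix (Fin 2) (Fin 2) (ZMod p)) *ᵥ v
      invFun := fun v ↦ ((M⁻¹ : GL (Fin 2) (ZMod p)) : Matrix (Fin 2) (Fin 2) (ZMod p)) *ᵥ v
      left_inv := fun v ↦ by
        simp only [Matrix.mulVec_mulVec, Units.inv_mul, Matrix.one_mulVec]
      right_inv := fun v ↦ by
        simp only [Matrix.mulVec_mulVec, Units.mul_inv, Matrix.one_mulVec]
      map_add' := fun v w ↦ Matrix.mulVec_add _ _ _ }
  have hf : ∀ v, f v = (M : Matrix (Fin 2) (Fin 2) (ZMod p)) *ᵥ v := fun _ ↦ rfl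
  obtain ⟨σ, hσ⟩ := hs (Multiplicative.ofAdd (e.trans (f.trans e.symm)))
  have hσP : ∀ P : geomTorsion W p, σ • P = e.symm (f (e P)) := fun P ↦ by
    have h := W.galoisRepTorsion_apply (p : ℤ) σ P
    rw [hσ, toAdd_ofAdd] at h
    exact h.symm
  refine ⟨σ, ?_⟩
  have hv : ∀ v : Fin 2 → ZMod p,
      ((ρ σ : GL (Fin 2) (ZMod p)) : Matrix (Fin 2) (Fin 2) (ZMod p)) *ᵥ v =
        (M : Matrix (Fin 2) (Fin 2) (ZMod p)) *ᵥ v := fun v ↦ by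
    have h := he σ (e.symm v)
    rw [hσP, AddEquiv.apply_symm_apply, AddEquiv.apply_symm_apply, hf] at h
    exact h.symm
  have hmat : ((ρ σ : GL (Fin 2) (ZMod p)) : Matrix (Fin 2) (Fin 2) (ZMod p)) =
      (M : Matrix (Fin 2) (Fin 2) (ZMod p)) :=
    Matrix.toLin'.injective (LinearMap.ext fun v ↦ by rw [Matrix.toLin'_apply, Matrix.toLin'_apply, hv])
  exact Units.ext hmat

/-- **TOP GLUE (PROVED): `CuspForcedSource ⇒ stub_switch`.**  The hypotheses `27 ∤ N` and "every
`ρ̄₃` small" of the stub are not used; `ρ̄` absolutely irreducible over `ℚ(√5)` IS used (by T1). -/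
theorem stubSwitch_of_cuspForcedSource (h : CuspForcedSource) : StubSwitch := by
  intro W _ _ _ ρ hρ hirr
  obtain ⟨W', hW', hc, hs⟩ := h W ρ hρ hirr
  haveI := hW'
  haveI : Fact (Nat.Prime 3) := ⟨Nat.prime_three⟩
  haveI : NeZero ((3 : ℕ) : ℚ) := ⟨by norm_num⟩
  obtain ⟨ρ₃, hρ₃⟩ := W'.exists_isTorsionGaloisRep 3
  exact ⟨W', hW', isTorsionGaloisRep_of_congr hc hρ, ρ₃, hρ₃,
    isAbsIrreducibleOverSqrt_neg_three_of_surjective ρ₃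
      (surjective_of_hasSurjectiveModNGaloisRep hs hρ₃)⟩

/-- and hence the registered stub's named fact. -/
theorem CDT_three_five_switch_of_cuspForcedSource (h : CuspForcedSource) : CDT_three_five_switch :=
  stubSwitch_iff_CDT_three_five_switch.mp (stubSwitch_of_cuspForcedSource h)

/-! ## Layer 2 — helpers for `CuspForcedSource` (each ≤ one prover cycle unless marked) -/

/-! ### (G) the Chebotarev target: `σ` with `ρ̄_{W,5}(σ) = −1` fixing `μ_m` (S/M, group theory) -/

/-- **G1 `helper_exists_neg_one_fixing_cyclotomic` (S/M).**  If `ρ̄ ≅ W[5]` is absolutely irreducible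
over `ℚ(√5)` (with `det ρ̄ = χ̄₅` onto, automatic for `W[5]`), then `−1 ∈ [G,G]` for `G = ρ̄(Γ_ℚ)`
(finite check over Dickson's list: such `G` is, up to conjugacy, `N(C_s)` (order 32), `N(C_ns)` (48),
the `S₄`-type group (96) or `GL₂(𝔽₅)` — verified by machine in `calc/gl25b.py`), so some
`σ ∈ [Γ_ℚ,Γ_ℚ] ≤ ker χ̄_m` acts as `−1` on `W[5]`. -/
theorem helper_exists_neg_one_fixing_cyclotomic (W : WeierstrassCurve ℚ) [W.IsElliptic]
    (ρ : ModPGaloisRep ℚ (ZMod 5) 2) (hρ : W.IsTorsionGaloisRep 5 ρ)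
    (hirr : ρ.IsAbsIrreducibleOverSqrt 5) (m : ℕ) [NeZero m] :
    ∃ σ : absoluteGaloisGroup ℚ, (∀ P : W.geomTorsion 5, σ • P = -P) ∧
      modNCyclotomicCharacter ℚ m σ = 1 := by
  sorry

/-- **G2 `helper_cyclotomic_eq_of_smul_eq` (S): equal actions on `W[n]` ⇒ equal `χ̄_n`**
(`det ρ̄_{W,n} = χ̄_n`, tree PROVED `det_eq_modNCyclotomicCharacter` for all `n ≥ 2`, applied to
both elements with one frame of `W[n]`). Used to move "`σ` fixes `μ_m`" to the Chebotarev Frobenius. -/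
theorem helper_cyclotomic_eq_of_smul_eq (W : WeierstrassCurve ℚ) [W.IsElliptic] {n : ℕ} [NeZero n]
    (hn : 2 ≤ n) {φ σ : absoluteGaloisGroup ℚ} (h : ∀ P : W.geomTorsion n, φ • P = σ • P) :
    modNCyclotomicCharacter ℚ n φ = modNCyclotomicCharacter ℚ n σ := by
  sorry

/-! ### (C) THE NEW INPUT — cusp splitting of Fisher's discriminant form `𝔇` (M; one named fact OR
one certified identity) -/

/-- **C1 `helper_cuspSplitting` (M — the load-bearing helper).**  For the integral `c₄c₆`-model
`E : y² = x³ − 27c₄x − 54c₆`, a prime `q ∤ 30(c₄³ − c₆²)` and an arithmetic Frobenius `φ` at `q`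
acting as `−1` on `E[5]`: Fisher's degree-`12` form `𝔇_E(λ,1)` has a SIMPLE root modulo `q`
(indeed it splits into `12` distinct linear factors).  Reason: the zeros of `𝔇_E` are the `12` cusps of
`X_E(5) ≅ ℙ¹` (poles of `j = 1728·𝔠₄³/((c₄³−c₆²)𝔇⁵)`), a `Γ_ℚ`-set isomorphic to `(E[5]∖0)/±1`;
NUMERICALLY the factorisation types of `𝔇_E(λ,1)` and of the `5`-division polynomial `ψ_{5,E}(x)`
agree at every good prime tested (5 curves × all `q ≤ 250…400`, `calc/etale.py`), and `Frob_q = −1`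
gives `12` roots (`q = 281` for `y² = x³+x+1`, `q = 181` for `y² = x³+x`).
Sources: Fisher2012Hessian §8, Thm 13.2; Rubin–Silverberg / Silverberg in cornell1997 (pp. 556–557:
Galois action on cusps); Klein's icosahedral form. -/
theorem helper_cuspSplitting (c₄ c₆ : ℤ) (hΔ : c₄ ^ 3 ≠ c₆ ^ 2)
    (hE : (base (c₄ : ℚ) (c₆ : ℚ)).IsElliptic)
    {q : ℕ} (hq : q.Prime) (hq30 : ¬ (q : ℤ) ∣ 30 * (c₄ ^ 3 - c₆ ^ 2))
    {v : HeightOneSpectrum (𝓞 ℚ)} (hv : (Rat.HeightOneSpectrum.primesEquiv v : ℕ) = q)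
    {𝔓 : Ideal (absIntegers (𝓞 ℚ) ℚ)} (h𝔓 : 𝔓 ∈ v.primesAbove)
    {φ : absoluteGaloisGroup ℚ} (hφ : IsArithFrobAt (𝓞 ℚ) φ 𝔓)
    (hneg : ∀ P : (base (c₄ : ℚ) (c₆ : ℚ)).geomTorsion 5, φ • P = -P) :
    ∃ r : ℤ, (q : ℤ) ∣ D c₄ c₆ r 1 ∧ ¬ (q : ℤ) ∣ Dl c₄ c₆ r 1 := by
  sorry

/-- **C1⁺ `CuspEtaleMatch` (optional STRONGER form, the conceptual statement behind C1; would be a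
Literature named fact "cusps of `X_E(5)` ≅ `(E[5]∖0)/±1`", or a certified identity
`𝔇_E(Θ_E(x),1) ≡ 0 mod ψ_{5,E}(x)` once the universal `Θ` is computed): prime-by-prime, `𝔇_E(λ,1)`
has a root mod `q` as soon as `φ` has an eigenvector with eigenvalue `±1` on `E[5]`.** -/
def CuspEtaleMatch : Prop :=
  ∀ (c₄ c₆ : ℤ), c₄ ^ 3 ≠ c₆ ^ 2 → ∀ (hE : (base (c₄ : ℚ) (c₆ : ℚ)).IsElliptic)
    (q : ℕ), q.Prime → ¬ (q : ℤ) ∣ 30 * (c₄ ^ 3 - c₆ ^ 2) →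
    ∀ (v : HeightOneSpectrum (𝓞 ℚ)), (Rat.HeightOneSpectrum.primesEquiv v : ℕ) = q →
    ∀ 𝔓 ∈ v.primesAbove, ∀ φ : absoluteGaloisGroup ℚ, IsArithFrobAt (𝓞 ℚ) φ 𝔓 →
    (∃ P : (base (c₄ : ℚ) (c₆ : ℚ)).geomTorsion 5, P ≠ 0 ∧ (φ • P = P ∨ φ • P = -P)) →
    ∃ r : ℤ, (q : ℤ) ∣ D c₄ c₆ r 1

/-- **C2 `helper_lift_simple_root` (S, elementary): a simple root mod `q` gives an integer `l` with
`v_q(𝔇(l,1)) = 1` exactly** (`𝔇(r + tq) ≡ 𝔇(r) + tq·𝔇_l(r) (mod q²)`; take `t ∈ {0,1}`). -/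
theorem helper_lift_simple_root {q : ℕ} (hq : q.Prime) (c₄ c₆ r : ℤ)
    (hr : (q : ℤ) ∣ D c₄ c₆ r 1) (hr' : ¬ (q : ℤ) ∣ Dl c₄ c₆ r 1) :
    ∃ l : ℤ, padicValInt q (D c₄ c₆ l 1) = 1 := by
  sorry

/-! ### (L) local structure at the cusp prime `q` (Tate curve; M) -/

/-- **L1 `helper_member_multiplicative` (S/M): the cusp-adjacent member is multiplicative at `q` with
`v_q(Δ_min) = 5`.**  Fisher's syzygy `𝔠₄³ − 𝔠₆² = (c₄³ − c₆²)𝔇⁵` (= `1728 Δ`; k3's H4, `ring`-heavy)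
gives `v_q(Δ(E_l)) = 5·v_q(𝔇(l,1)) = 5` and `q ∤ 𝔠₄(l,1)` (else `q ∣ 𝔠₆` too, … ; directly:
`Res_λ(𝔠₄, 𝔇) = const·(c₄³−c₆²)^k`), so the integral model `E_l` is minimal at `q`, of multiplicative
type (Tate's algorithm, `v(c₄) = 0 < v(Δ)`; tree `Rank1Residual.O6.multiplicative_of_unit_c4` road). -/
theorem helper_member_multiplicative (c₄ c₆ l : ℤ) (hΔ : c₄ ^ 3 ≠ c₆ ^ 2) {q : ℕ} (hq : q.Prime)
    (hq30 : ¬ (q : ℤ) ∣ 30 * (c₄ ^ 3 - c₆ ^ 2)) (hl : padicValInt q (D c₄ c₆ l 1) = 1)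
    {v : HeightOneSpectrum (𝓞 ℚ)} (hv : (Rat.HeightOneSpectrum.primesEquiv v : ℕ) = q) :
    ∃ (_ : (member (c₄ : ℚ) c₆ l 1).IsElliptic),
      (member (c₄ : ℚ) c₆ l 1).HasMultiplicativeReductionAt v ∧
      (member (c₄ : ℚ) c₆ l 1).ordMinimalDiscriminant v = 5 := by
  sorry

/-- **L2 `helper_tate_line` (M): the Tate line.**  `E/ℚ` multiplicative at `v ∣ q`, `q ∤ n`: there is
`P₀ ∈ E[n]` of exact order `n`, fixed by the inertia at `𝔓 ∣ q`, on which an arithmetic Frobenius acts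
by `δ·q` with `δ = ±1` (`δ = 1` iff split) — the image of `μ_n ⊗ δ` under the (twisted) Tate
uniformisation (Silverman *ATAEC* V.5.3–5.4, C.14.1; tree `TateCurve/NumberFieldUniformizationTwisted*`,
`TorsionGaloisModuleKummer`).  Used ONCE with `n = 15`, so that `3•P₀ ∈ E[5]` and `5•P₀ ∈ E[3]` carry
the SAME `δ`. -/
theorem helper_tate_line (E : WeierstrassCurve ℚ) [E.IsElliptic] {q : ℕ} (hq : q.Prime)
    {v : HeightOneSpectrum (𝓞 ℚ)} (hv : (Rat.HeightOneSpectrum.primesEquiv v : ℕ) = q)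
    (hmult : E.HasMultiplicativeReductionAt v) {n : ℕ} [NeZero n] (hqn : ¬ q ∣ n)
    {𝔓 : Ideal (absIntegers (𝓞 ℚ) ℚ)} (h𝔓 : 𝔓 ∈ v.primesAbove)
    {φ : absoluteGaloisGroup ℚ} (hφ : IsArithFrobAt (𝓞 ℚ) φ 𝔓) :
    ∃ P₀ : E.geomTorsion n, addOrderOf P₀ = n ∧
      (∀ τ ∈ 𝔓.inertia (absoluteGaloisGroup ℚ), τ • P₀ = P₀) ∧
      ∃ d : ℤ, (d = q ∨ d = -(q : ℤ)) ∧ φ • P₀ = d • P₀ := by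
  sorry

/-- **L3 `helper_inertia_moves_torsion` (M): the `ℓ ≠ p` transvection.**  `E/ℚ` multiplicative at
`v ∣ q`, `ℓ ≠ q` prime with `ℓ ∤ v_q(Δ_min)`: some element of the inertia group at `𝔓 ∣ q` moves a
point of `E[ℓ]` (Kummer: `q_E^{1/ℓ} ∉ ℚ_q^{nr}`; Silverman *ATAEC* V.6.1 — the tree PROVED the harder
`ℓ = p` case `exists_inertia_transvection_of_hasMultiplicativeReductionAt_of_not_dvd`; with the tree's
unipotence `smul_smul_sub_eq_of_mem_inertia_geomPoints` the inertia-fixed part of `E[ℓ]` is then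
EXACTLY a line). -/
theorem helper_inertia_moves_torsion (E : WeierstrassCurve ℚ) [E.IsElliptic] {q ℓ : ℕ} (hq : q.Prime)
    [Fact ℓ.Prime] (hℓq : ℓ ≠ q) {v : HeightOneSpectrum (𝓞 ℚ)}
    (hv : (Rat.HeightOneSpectrum.primesEquiv v : ℕ) = q) (hmult : E.HasMultiplicativeReductionAt v)
    (hndvd : ¬ ℓ ∣ E.ordMinimalDiscriminant v)
    {𝔓 : Ideal (absIntegers (𝓞 ℚ) ℚ)} (h𝔓 : 𝔓 ∈ v.primesAbove) :
    ∃ τ ∈ 𝔓.inertia (absoluteGaloisGroup ℚ), ∃ P : E.geomTorsion ℓ, τ • P ≠ P := by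
  sorry

/-- **L4 `helper_three_dvd_card_of_inertia_moves` (S): a unipotent element moving a point of `E[3]`
has image of order `3`, so `3 ∣ #ρ̄_{E,3}(Γ_ℚ)`.** -/
theorem helper_three_dvd_card_of_inertia_moves (E : WeierstrassCurve ℚ) [E.IsElliptic]
    (τ : absoluteGaloisGroup ℚ) (hunip : ∀ P : E.geomTorsion 3, τ • (τ • P - P) = τ • P - P)
    (hmove : ∃ P : E.geomTorsion 3, τ • P ≠ P) :
    3 ∣ Nat.card (galoisRepTorsion E ((3 : ℕ) : ℤ)).range := by
  sorry

/-! ### (R) the global half: isogeny characters and quadratic fields (S/M) -/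

/-- **R1 `helper_stable_line_of_not_irreducible` (S): reducible ⇒ a stable line** (a proper non-zero
stable subgroup of `E[3] ≅ 𝔽₃²` is a line `{0, P, −P}`); feed to the tree's
`Mazur1978.exists_isogenyCharacter` to get its character `r : Γ_ℚ → 𝔽₃ˣ`. -/
theorem helper_stable_line_of_not_irreducible (E : WeierstrassCurve ℚ) [E.IsElliptic]
    (h : ¬ E.HasIrreducibleModPGaloisRep 3) :
    ∃ P : E.geomTorsion 3, P ≠ 0 ∧
      ∀ σ : absoluteGaloisGroup ℚ, σ • P ∈ AddSubgroup.zmultiples P := by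
  sorry

/-- **R2 `helper_isogenyCharacter_unramified` (S): the character of a stable line of `E[3]` is
unramified at every `v ∤ 3` where `E` is not additive** (good: Néron–Ogg–Shafarevich, tree
`Mazur1978.isogenyCharacter_eq_one_of_mem_inertia`; multiplicative: unipotent inertia, tree
`smul_smul_sub_eq_of_mem_inertia_geomPoints` — both cases are the `rcases` branches of the tree's
`isogenyCharacter_eq_one_of_mem_inertia_of_isSemistable`, which only needs the LOCAL hypothesis). -/
theorem helper_isogenyCharacter_unramified (E : WeierstrassCurve ℚ) [E.IsElliptic]
    [Fact (Nat.Prime 3)] {P : E.geomTorsion 3} (hP0 : P ≠ 0)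
    {r : absoluteGaloisGroup ℚ →* (ZMod 3)ˣ}
    (hr : ∀ σ : absoluteGaloisGroup ℚ, σ • P = ((r σ : (ZMod 3)ˣ) : ZMod 3).val • P)
    {v : HeightOneSpectrum (𝓞 ℚ)} (h3v : ((3 : ℕ) : 𝓞 ℚ) ∉ v.asIdeal)
    (hadd : ¬ E.HasAdditiveReductionAt v)
    {𝔓 : Ideal (absIntegers (𝓞 ℚ) ℚ)} (h𝔓 : 𝔓 ∈ v.primesAbove)
    {τ : absoluteGaloisGroup ℚ} (hτ : τ ∈ 𝔓.inertia (absoluteGaloisGroup ℚ)) : r τ = 1 := by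
  sorry

/-- **R3 `helper_not_additive_transfer` (S): additive reduction at `p ≠ 5` is read on `E[5]`, hence
transfers along a `5`-congruence** (the landed `stub_nineTransfer` with `3` replaced by any prime
`p ≠ 5`: `sq_dvd_conductorNorm_iff_hasAdditiveReductionAt`,
`exists_ne_zero_smul_eq_of_not_hasAdditiveReductionAt`, `exists_torsion_of_isTorsionGaloisRep`,
`stub_nineTransfer_torsion` — the last needs only `ℓ = 5 > 4 ≥ exponent of the component group`). -/
theorem helper_not_additive_transfer (W W' : WeierstrassCurve ℚ) [W.IsElliptic] [W'.IsElliptic]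
    (h : Congr W' W) {p : ℕ} (hp : p.Prime) (hp5 : p ≠ 5) :
    ¬ p ^ 2 ∣ W.conductorNorm ℤ → ¬ p ^ 2 ∣ W'.conductorNorm ℤ := by
  sorry

/-- **R4 `helper_quadratic_character_cyclotomic` (M): a character `Γ_ℚ → 𝔽₃ˣ = {±1}` unramified
outside the finite set `T` is trivial on every `σ` fixing `μ_m`, `8·∏_{p∈T} p ∣ m`** (Kronecker–Weber,
tree PROVED `KroneckerWeber_holds` / `exists_comp_modNCyclotomicCharacter_eq`: `ψ = β ∘ χ̄_M`; the tree's
`exists_mem_inertia_modNCyclotomicCharacter_eq` kills the primes of `M` outside `T`; a quadratic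
character of `(ℤ/p^e)ˣ` factors through `(ℤ/p)ˣ` (`p` odd) resp. `(ℤ/8)ˣ`). -/
theorem helper_quadratic_character_cyclotomic (ψ : absoluteGaloisGroup ℚ →* (ZMod 3)ˣ)
    (hker : IsOpen ((ψ.ker : Subgroup (absoluteGaloisGroup ℚ)) : Set (absoluteGaloisGroup ℚ)))
    (T : Finset ℕ)
    (hunr : ∀ (v : HeightOneSpectrum (𝓞 ℚ)), (Rat.HeightOneSpectrum.primesEquiv v : ℕ) ∉ T →
      ∀ 𝔓 ∈ v.primesAbove, ∀ τ ∈ 𝔓.inertia (absoluteGaloisGroup ℚ), ψ τ = 1)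
    {m : ℕ} [NeZero m] (h8 : 8 ∣ m) (hT : ∀ p ∈ T, p ∣ m)
    (σ : absoluteGaloisGroup ℚ) (hσ : modNCyclotomicCharacter ℚ m σ = 1) : ψ σ = 1 := by
  sorry

/-- **R5 `helper_surjective_three_of_irreducible_of_three_dvd` (S given the tree): irreducible and
`3 ∣ #G` ⇒ `ρ̄_{E,3}` onto** (Serre 1972 Prop. 15 at `p = 3`: tree PROVED
`Serre1972.eq_top_or_borel_of_dvd_card` + `det = χ̄₃` onto via `exists_frame_galoisRepTorsion_rat`;
= k3's H3 with its cube hypothesis replaced by the conclusion of L4). -/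
theorem helper_surjective_three_of_irreducible_of_three_dvd (E : WeierstrassCurve ℚ) [E.IsElliptic]
    (hirr : E.HasIrreducibleModPGaloisRep 3)
    (h3 : 3 ∣ Nat.card (galoisRepTorsion E ((3 : ℕ) : ℤ)).range) :
    E.HasSurjectiveModNGaloisRep ((3 : ℕ) : ℤ) := by
  sorry

/-! ### (F) the family input (tree NAMED FACT, no new content) -/

/-- **F1 (S): Fisher's Theorem 13.2 as a `Congr`** — the member `E_{l,1}` with `𝔇(l,1) ≠ 0` is
`5`-congruent to the `c₄c₆`-model (tree named fact `thm132_geomTorsionFive_of_hesseFamily`, used as a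
hypothesis exactly as k3's `ellipticSourceSwitch_of_member` does). -/
theorem congr_member_base (hF : thm132_geomTorsionFive_of_hesseFamily) (c₄ c₆ l : ℚ)
    [hE : (base c₄ c₆).IsElliptic] [hE' : (member c₄ c₆ l 1).IsElliptic] :
    Congr (member c₄ c₆ l 1) (base c₄ c₆) := by
  obtain ⟨e, he⟩ := hF (base c₄ c₆) (member c₄ c₆ l 1) c₄ c₆ l 1 rfl rfl
  exact ⟨e, he⟩

/-! ## Assembly of Layer 2 (PROSE; the typed composition is the prover's job — see the md §4):
`thm132 ∧ G1 ∧ G2 ∧ chebotarev_geomTorsion_holds ∧ C1 ∧ C2 ∧ L1–L4 ∧ R1–R5 ⇒ CuspForcedSource`. -/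

/-- The assembly target, recorded as an implication so the dependency is machine-visible
(hypothesis list = the helper statements that are not yet in the tree). -/
theorem cuspForcedSource_of_helpers_shape :
    (thm132_geomTorsionFive_of_hesseFamily → CuspEtaleMatch → CuspForcedSource) →
    thm132_geomTorsionFive_of_hesseFamily → CuspEtaleMatch → StubSwitch :=
  fun h hF hC => stubSwitch_of_cuspForcedSource (h hF hC)

end Summit.ABC.ABC.Cruxes.FreyModularity.StubSwitchIdeas2G2

end
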